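import Summits.Ventures.GridStability.Models.DroopQVGainAffine

/-!
# GridStability/Models/DroopQVGainQAffine — the droop+QV Jacobian is AFFINE in the Q–V droop gains too; two-parameter (P–f × Q–V) gain boxes

Cell `gridfusion` (LADDER-GRIDFUSION, APEX LINE rung G3.b; seat gridfusion-model-8 (g4); generic half of the default-work item «G3.b-ss-DROOPQV-…-GAINBOX-2D»,
sequel of `Models/DroopQVGainAffine.lean` p558197). In model N1 (`DroopMicrogrid`, [cite: KunduEtAl2019, eqs. (4a)–(4c)]) the Q–V droop gains `k_Qi` enter only
the voltage rows `V̇_i = (v⁰_i − V_i + k_Qi(Q^set_i − Q_i))/τ_Qi`: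
* §1 `withKQ κ` (the same microgrid with Q–V gains `κ`): flows, set-points, rest points, sensitivity blocks unchanged; the Jacobian is AFFINE in the Q–V
  gains, `jacMatrix (withKQ (k_Q + s·w)) = jacMatrix + s • jacSlopeKQ w` (`jacMatrix_withKQ_add`), the slope
  `jacSlopeKQ w = [[0, 0, 0], [0, 0, 0], [−diag(w/τ_Q)·Qθ, 0, −diag(w/τ_Q)·QV]]` living in the VOLTAGE ROWS only; the P–f slope `jacSlope` of p558197
  lives in the frequency rows, so the Jacobian of `(withKP κ).withKQ κ'` is JOINTLY affine in the two gain vectors (`jacMatrix_withKP_withKQ_add`);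
* §2 the two-parameter vertex principle `posDef_biaffine_of_corners`: a symmetric pencil `M₀₀ + a·M₁₀ + b·M₀₁ + ab·M₁₁` (affine in each parameter
  separately) is positive definite on a box as soon as it is at the four corners (the segment lemma `posDef_affine_of_endpoints` twice);
* §3 the ℚ-twin `DroopQVData.jacSlopeKQQ` with its bridge.
Instance files choose a MULTI-AFFINE Lyapunov family `S = S₀ + a·S_P + b·S_Q + ab·S_PQ` with `S_P` on the angle/voltage block, `S_Q` on the angle/frequency
block and `S_PQ` on the angle block, so that every product of a slope of `S` with a slope of `J` it meets vanishes and the certificate matrix is multi-affine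
too — eight corner certificates then cover the box. THREE COLUMNS. CERTIFIED (kernel): algebra about MODEL N1 (MV-6N) and linear algebra; no numbers, no
instance; no sentence of this file says a converter or a microgrid is stable.
-/

noncomputable section

open Real Matrix Finset
open scoped ComplexOrder

namespace Summit.Ventures.GridStability.Models

/-! ## §2 The two-parameter vertex principle -/

section Biaffine

variable {ι : Type*}

/-- **Positive definiteness on a box from the four corners** for a pencil that is affine in each of two parameters separately. [folklore] -/
theorem posDef_biaffine_of_corners {M₀₀ M₁₀ M₀₁ M₁₁ : Matrix ι ι ℝ} {a₁ a₂ b₁ b₂ a b : ℝ}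
    (h11 : (M₀₀ + a₁ • M₁₀ + b₁ • M₀₁ + (a₁ * b₁) • M₁₁).PosDef) (h12 : (M₀₀ + a₁ • M₁₀ + b₂ • M₀₁ + (a₁ * b₂) • M₁₁).PosDef)
    (h21 : (M₀₀ + a₂ • M₁₀ + b₁ • M₀₁ + (a₂ * b₁) • M₁₁).PosDef) (h22 : (M₀₀ + a₂ • M₁₀ + b₂ • M₀₁ + (a₂ * b₂) • M₁₁).PosDef)
    (ha₁ : a₁ ≤ a) (ha₂ : a ≤ a₂) (hb₁ : b₁ ≤ b) (hb₂ : b ≤ b₂) :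
    (M₀₀ + a • M₁₀ + b • M₀₁ + (a * b) • M₁₁).PosDef := by
  -- for fixed first parameter `c` the pencil is affine in `b`
  have hrow : ∀ c x : ℝ, M₀₀ + c • M₁₀ + x • M₀₁ + (c * x) • M₁₁ = (M₀₀ + c • M₁₀) + x • (M₀₁ + c • M₁₁) := by
    intro c x; rw [smul_add, smul_smul, mul_comm x c]; abel
  -- for fixed second parameter `b` the pencil is affine in `a`
  have hcol : ∀ x : ℝ, M₀₀ + x • M₁₀ + b • M₀₁ + (x * b) • M₁₁ = (M₀₀ + b • M₀₁) + x • (M₁₀ + b • M₁₁) := by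
    intro x; rw [smul_add, smul_smul]; abel
  have h1 : (M₀₀ + a₁ • M₁₀ + b • M₀₁ + (a₁ * b) • M₁₁).PosDef := by
    rw [hrow] at h11 h12 ⊢; exact posDef_affine_of_endpoints h11 h12 hb₁ hb₂
  have h2 : (M₀₀ + a₂ • M₁₀ + b • M₀₁ + (a₂ * b) • M₁₁).PosDef := by
    rw [hrow] at h21 h22 ⊢; exact posDef_affine_of_endpoints h21 h22 hb₁ hb₂
  rw [hcol] at h1 h2 ⊢
  exact posDef_affine_of_endpoints h1 h2 ha₁ ha₂

/-- Cast plumbing for multi-affine pencils of rational literals. [folklore] -/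
theorem map_ratCast_biaffine (X Y Z W : Matrix ι ι ℚ) (p q : ℚ) :
    (X + p • Y + q • Z + (p * q) • W).map ((↑) : ℚ → ℝ)
      = X.map ((↑) : ℚ → ℝ) + (p : ℝ) • Y.map ((↑) : ℚ → ℝ) + (q : ℝ) • Z.map ((↑) : ℚ → ℝ) + ((p : ℝ) * (q : ℝ)) • W.map ((↑) : ℚ → ℝ) := by
  ext i j
  simp only [Matrix.map_apply, Matrix.add_apply, Matrix.smul_apply, smul_eq_mul]
  push_cast
  ring

end Biaffine

/-! ## §1 The model with other Q–V droop gains; the Jacobian is affine in them -/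

namespace DroopMicrogrid

variable {n : ℕ} (mg : DroopMicrogrid n)

/-- **The same droop microgrid with Q–V droop gains `κ`** (everything else unchanged). [cite: KunduEtAl2019, eq. (4c)] -/
def withKQ (κ : Fin n → ℝ) : DroopMicrogrid n := { mg with kQ := κ }

variable (κ : Fin n → ℝ)

/-- Gains of `withKQ κ`. [folklore] -/
@[simp] theorem withKQ_kQ : (mg.withKQ κ).kQ = κ := rfl
/-- Unchanged data of `withKQ κ`. [folklore] -/
@[simp] theorem withKQ_kP : (mg.withKQ κ).kP = mg.kP := rfl
/-- Unchanged data of `withKQ κ`. [folklore] -/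
@[simp] theorem withKQ_τP : (mg.withKQ κ).τP = mg.τP := rfl
/-- Unchanged data of `withKQ κ`. [folklore] -/
@[simp] theorem withKQ_τQ : (mg.withKQ κ).τQ = mg.τQ := rfl
/-- Unchanged data of `withKQ κ`. [folklore] -/
@[simp] theorem withKQ_Vset : (mg.withKQ κ).Vset = mg.Vset := rfl
/-- The flows do not read the gains. [folklore] -/
@[simp] theorem withKQ_P : (mg.withKQ κ).P = mg.P := rfl
/-- The flows do not read the gains. [folklore] -/
@[simp] theorem withKQ_Q : (mg.withKQ κ).Q = mg.Q := rfl
/-- The sensitivity blocks do not read the gains. [folklore] -/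
@[simp] theorem withKQ_Pθ : (mg.withKQ κ).Pθ = mg.Pθ := rfl
/-- The sensitivity blocks do not read the gains. [folklore] -/
@[simp] theorem withKQ_PV : (mg.withKQ κ).PV = mg.PV := rfl
/-- The sensitivity blocks do not read the gains. [folklore] -/
@[simp] theorem withKQ_Qθ : (mg.withKQ κ).Qθ = mg.Qθ := rfl
/-- The sensitivity blocks do not read the gains. [folklore] -/
@[simp] theorem withKQ_QV : (mg.withKQ κ).QV = mg.QV := rfl
/-- Frequency-row gains unchanged. [folklore] -/
@[simp] theorem withKQ_ΛP : (mg.withKQ κ).ΛP = mg.ΛP := rfl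
/-- Voltage-row gains of `withKQ κ`: `κ_i/τ_Qi`. [folklore] -/
@[simp] theorem withKQ_ΛQ (i : Fin n) : (mg.withKQ κ).ΛQ i = κ i / mg.τQ i := rfl
/-- The P–f slope does not read the Q–V gains. [folklore] -/
@[simp] theorem withKQ_jacSlope (w : Fin n → ℝ) : (mg.withKQ κ).jacSlope w = mg.jacSlope w := rfl

/-- **The steady states do not depend on the Q–V gains.** [cite: KunduEtAl2019, after (5b)] -/
theorem withKQ_isSteadyState_iff (θs : Fin n → ℝ) : (mg.withKQ κ).IsSteadyState θs ↔ mg.IsSteadyState θs := Iff.rfl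

/-- **The rest point does not move with the Q–V gains.** [folklore] -/
theorem withKQ_field_eq_zero {θs : Fin n → ℝ} (h : mg.IsSteadyState θs) : (mg.withKQ κ).field (θs, 0, mg.Vset) = 0 :=
  (mg.withKQ κ).field_eq_zero_of_isSteadyState ((mg.withKQ_isSteadyState_iff κ θs).2 h)

/-- **The Q–V gain slope of the Jacobian in the direction `w`**, at a state `(θ, V)`:
`[[0, 0, 0], [0, 0, 0], [−diag(w/τ_Q)·Qθ, 0, −diag(w/τ_Q)·QV]]` — voltage rows only. [folklore] -/
def jacSlopeKQ (w : Fin n → ℝ) (θ V : Fin n → ℝ) : Matrix (Fin n ⊕ (Fin n ⊕ Fin n)) (Fin n ⊕ (Fin n ⊕ Fin n)) ℝ :=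
  Matrix.fromBlocks 0 0
    (Matrix.fromRows 0 (-(Matrix.diagonal (fun i => w i / mg.τQ i) * mg.Qθ θ V)))
    (Matrix.fromBlocks 0 0 0 (-(Matrix.diagonal (fun i => w i / mg.τQ i) * mg.QV θ V)))

/-- The P–f family does not read the Q–V slope. [folklore] -/
@[simp] theorem withKP_jacSlopeKQ (κ' w : Fin n → ℝ) : (mg.withKP κ').jacSlopeKQ w = mg.jacSlopeKQ w := rfl

/-- **The Jacobian is AFFINE in the Q–V droop gains**: moving them from `k_Q` to `k_Q + s·w` adds `s • jacSlopeKQ w`. [folklore] -/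
theorem jacMatrix_withKQ_add (w : Fin n → ℝ) (s : ℝ) (θ V : Fin n → ℝ) :
    (mg.withKQ (fun i => mg.kQ i + s * w i)).jacMatrix θ V = mg.jacMatrix θ V + s • mg.jacSlopeKQ w θ V := by
  ext a b
  rcases a with i | i | i <;> rcases b with j | j | j <;>
    simp [DroopMicrogrid.jacMatrix, jacSlopeKQ, DroopMicrogrid.ΛQ, Matrix.fromBlocks, Matrix.fromRows,
      Matrix.fromCols, Matrix.add_apply, Matrix.neg_apply, Matrix.mul_apply, Matrix.one_apply, Matrix.diagonal_apply] <;>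
    ring

/-- **Joint affinity in both gain vectors**: `jacMatrix ((withKP (k_P + s·w)).withKQ (k_Q + t·w')) = jacMatrix + s • jacSlope w + t • jacSlopeKQ w'`.
[folklore] -/
theorem jacMatrix_withKP_withKQ_add (w w' : Fin n → ℝ) (s t : ℝ) (θ V : Fin n → ℝ) :
    ((mg.withKP (fun i => mg.kP i + s * w i)).withKQ (fun i => mg.kQ i + t * w' i)).jacMatrix θ V
      = mg.jacMatrix θ V + s • mg.jacSlope w θ V + t • mg.jacSlopeKQ w' θ V := by
  have h := (mg.withKP (fun i => mg.kP i + s * w i)).jacMatrix_withKQ_add w' t θ V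
  rw [withKP_kQ] at h
  rw [h, jacMatrix_withKP_add, withKP_jacSlopeKQ]

/-- Same for the deflated Jacobian (the deflation does not read the gains). [folklore] -/
theorem jacDefl_withKP_withKQ_add (w w' : Fin n → ℝ) (s t : ℝ) (θ V : Fin n → ℝ) (ζ : Fin n ⊕ (Fin n ⊕ Fin n) → ℝ) :
    ((mg.withKP (fun i => mg.kP i + s * w i)).withKQ (fun i => mg.kQ i + t * w' i)).jacDefl θ V ζ
      = mg.jacDefl θ V ζ + s • mg.jacSlope w θ V + t • mg.jacSlopeKQ w' θ V := by
  rw [DroopMicrogrid.jacDefl, DroopMicrogrid.jacDefl, jacMatrix_withKP_withKQ_add]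
  abel

end DroopMicrogrid

/-! ## §3 The ℚ-twin of the Q–V gain slope at the operating point of a `DroopQVData` instance -/

namespace DroopQVData

variable {n : ℕ} (d : DroopQVData n)

/-- ℚ-twin of `jacSlopeKQ 1 (θ*, V*)` (uniform direction): voltage rows `−diag(1/τ_Q)·QθQ` and `−diag(1/τ_Q)·QVQ`. [folklore] -/
def jacSlopeKQQ : Matrix (Fin (n + 1) ⊕ (Fin (n + 1) ⊕ Fin (n + 1))) (Fin (n + 1) ⊕ (Fin (n + 1) ⊕ Fin (n + 1))) ℚ :=
  Matrix.fromBlocks 0 0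
    (Matrix.fromRows 0 (-(Matrix.diagonal (fun i => 1 / d.τQ i) * d.QθQ)))
    (Matrix.fromBlocks 0 0 0 (-(Matrix.diagonal (fun i => 1 / d.τQ i) * d.QVQ)))

/-- **Bridge for the Q–V slope**: `jacSlopeKQ 1 (θ*, V*)` of the instance model IS `jacSlopeKQQ` cast. [folklore] -/
theorem jacSlopeKQ_eq (hcirc : ∀ i, d.s i ^ 2 + d.c i ^ 2 = 1) :
    d.toMicrogrid.jacSlopeKQ (fun _ => (1 : ℝ)) d.angleOf d.Vstar = d.jacSlopeKQQ.map ((↑) : ℚ → ℝ) := by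
  have hg := fun i => d.toMicrogrid_gains i
  rw [DroopMicrogrid.jacSlopeKQ, d.Qθ_eq hcirc, d.QV_eq hcirc, jacSlopeKQQ]
  ext (i | i | i) (j | j | j) <;>
    simp [Matrix.fromBlocks, Matrix.fromRows, Matrix.mul_apply, Matrix.diagonal_apply, (hg i).2.1]

/-- The Q–V gains of the instance model are the rational data (cast). [folklore] -/
theorem toMicrogrid_kQ (i : Fin (n + 1)) : d.toMicrogrid.kQ i = (d.kQ i : ℝ) := rfl

end DroopQVData

end Summit.Ventures.GridStability.Models

end
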